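import Mathlib
import Summits.Ventures.PercRepro2.LeafHalfCross
import Summits.Ventures.PercRepro2.LeafHalfCrossRed

/-!
# The «`G2`» grouping split along the `v`-world of `C₂` (blind cell PercRepro2, p5 g26;
`proofs/P5-OEDGE.md` §33, `proofs/subclaims/S4-HARDSTEP.md` v106)

`LeafHalfCross` reduces row (LEAF-½) to the two «`G2`» groupings `0 ≤ groupL`, `0 ≤ groupH`
(`LeafHalfCrossRed.LeafRow_of_G2`), where `groupL = P(Q)³·[N_bo + ⟨U_o⟩ N_bv + Cov_Q(L_b, H_v U_o)]`
is the cleared form of the candidate `(G2): N(H_v U_o) ≤ N(H_o) + ⟨U_o⟩ N(H_v)` under `Q = {a₁ ↮ a₂}`.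
This file splits `groupL` by the law of total covariance over the event `{v ∈ C₂}` (`π = P(Q, vH)/P(Q)`,
`W = P(Q) − P(Q, vH) = P(a₂ ↮ {a₁, v})` the pair-avoidance mass):

  `groupL = starL + g2one + P(Q) · y1`   (`groupL_eq_split`, a polynomial identity), where

* `y1 = P(Q, bL, ¬vH)·P(Q, oH, ¬vH) − W·P(Q, bL, oH, ¬vH)` `= P(Q)·W·(1 − π)·(−Cov_Q(L_b, H_o | v ∉ C₂))`
  is **nonnegative** — BHK06 Thm 1.4 under the pair avoidance `{a₂ ↮ a₁, a₂ ↮ v}` (`y1_nonneg`,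
  from `cross_pair_avoid`);
* `starL = W·[P(Q)·P(Q, bL, oL) − P(Q, bL)·P(Q, oL)] − P(Q)·[W·P(Q, bL, oL, ¬vH) − P(Q, bL, ¬vH)·P(Q, oL, ¬vH)]`
  `= P(Q)²·W·[Cov_Q(L_b, L_o) − (1 − π)·Cov_Q(L_b, L_o | v ∉ C₂)]` — the «conditional-share» statement
  (STAR) for the pair `(L_b, L_o)`: the mass-weighted positive association of `C₁` may only decrease when
  `a₂` is made to avoid `v` as well; census-true, an instance of the one-cluster candidate of P5-OEDGE §33;
* `g2one = P(Q, vH)·[P(Q, bL)·P(Q, oH) − P(Q)·P(Q, bL, oH)] + P(Q)·[P(Q, vH)·P(Q, bL, vH, oU) − P(Q, bL, vH)·P(Q, vH, oU)]`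
  `= P(Q)²·P(Q, vH)·[N_bo + π·Cov_Q(L_b, U_o | v ∈ C₂)]` — the `β`-shift-free form «`G2₁`» of the candidate
  (`N(H_v U_o) ≤ N(H_o) + ⟨U_o | v ∈ C₂⟩ N(H_v)`), census-true.

Consequences: `0 ≤ starL → 0 ≤ g2one → 0 ≤ groupL` (`groupL_nonneg_of_star_g2one`), hence row (LEAF-½)
from the four statements on the two halves (`LeafRow_of_star_g2one`); and the **regime theorem**
`groupL_nonneg_of_star_of_cov_nonneg`: `0 ≤ groupL` already follows from `0 ≤ starL` alone whenever
`Cov_Q(U_o, H_v) ≥ 0` (`shiftU ≤ 0`), by the second identity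
`groupL · W = P(Q)·starL + P(Q)²·y1 − shiftB·shiftU` (`groupL_mul_W_eq`) with
`shiftB = P(Q, bL)·P(Q, vH) − P(Q)·P(Q, bL, vH) ≥ 0` (BHK 1.4) and
`shiftU = P(Q, oU)·P(Q, vH) − P(Q)·P(Q, vH, oU) = −P(Q)²·Cov_Q(U_o, H_v)`; the degenerate corner
`W = 0` (`v ∈ C₂` a.s. under `Q`) is `groupL = P(Q)·[P(Q)·P(Q, bL, oL) − P(Q, bL)·P(Q, oL)] ≥ 0`,
BHK06 Thm 1.1 for the two `C₁`-events (`same_cluster_bo`).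

Nothing here claims `0 ≤ starL` or `0 ≤ g2one`; both are census-true candidates (P5-OEDGE §33).
-/

namespace Summit.Ventures.PercRepro2

open UnionCluster CovForm PendantRoot LeafStep

namespace LeafHalfCross

variable {V : Type*} {E : Type*} [Fintype E] [DecidableEq E] [Fintype V] [DecidableEq V]
  {R : Type*} [Field R] [LinearOrder R] [IsStrictOrderedRing R]

section Masses

variable (p : E → R) (ends : E → Sym2 V)

/-- `P(Q)`, `Q = {a₂ ↮ a₁}`. -/
noncomputable def mQ (a₁ a₂ : V) : R := prob p (avoidAll ends a₂ {a₁})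

/-- `P(Q, x ∈ C₁)`. -/
noncomputable def mL (a₁ a₂ x : V) : R := prob p (avoidAll ends a₂ {a₁} ∩ connEvent ends a₁ x)

/-- `P(Q, x ∈ C₂)`. -/
noncomputable def mH (a₁ a₂ x : V) : R := prob p (avoidAll ends a₂ {a₁} ∩ connEvent ends a₂ x)

/-- `P(Q, x ∈ C₂, y ∈ C₁)`. -/
noncomputable def mHL (a₁ a₂ x y : V) : R :=
  prob p (avoidAll ends a₂ {a₁} ∩ (connEvent ends a₂ x ∩ connEvent ends a₁ y))

/-- `P(Q, x ∈ C₁, y ∈ C₁)`. -/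
noncomputable def mLL (a₁ a₂ x y : V) : R :=
  prob p (avoidAll ends a₂ {a₁} ∩ (connEvent ends a₁ x ∩ connEvent ends a₁ y))

/-- `P(Q, x ∈ C₂, y ∈ C₂)`. -/
noncomputable def mHH (a₁ a₂ x y : V) : R :=
  prob p (avoidAll ends a₂ {a₁} ∩ (connEvent ends a₂ x ∩ connEvent ends a₂ y))

/-- `P(Q, v ∈ C₂, x ∈ C₁, y ∈ C₁)`. -/
noncomputable def mHLL (a₁ a₂ v x y : V) : R :=
  prob p (avoidAll ends a₂ {a₁} ∩
    (connEvent ends a₂ v ∩ (connEvent ends a₁ x ∩ connEvent ends a₁ y)))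

/-- `P(Q, v ∈ C₂, x ∈ C₂, y ∈ C₁)`. -/
noncomputable def mHHL (a₁ a₂ v x y : V) : R :=
  prob p (avoidAll ends a₂ {a₁} ∩
    (connEvent ends a₂ v ∩ (connEvent ends a₂ x ∩ connEvent ends a₁ y)))

end Masses

section Defs

variable (p : E → R) (ends : E → Sym2 V)

/-- **`starL`** — the cleared «conditional share» statement (STAR) for the pair `(L_b, L_o)`:
`W·[P(Q)·P(Q,bL,oL) − P(Q,bL)·P(Q,oL)] − P(Q)·[W·P(Q,bL,oL,¬vH) − P(Q,bL,¬vH)·P(Q,oL,¬vH)]`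
with `W = P(Q) − P(Q,vH)` (`= P(Q)²·W·[Cov_Q(L_b,L_o) − (1 − π)·Cov_Q(L_b,L_o | v ∉ C₂)]`). -/
noncomputable def starL (o a₁ a₂ v b : V) : R :=
  (mQ p ends a₁ a₂ - mH p ends a₁ a₂ v) *
      (mQ p ends a₁ a₂ * mLL p ends a₁ a₂ o b - mL p ends a₁ a₂ b * mL p ends a₁ a₂ o) -
    mQ p ends a₁ a₂ *
      ((mQ p ends a₁ a₂ - mH p ends a₁ a₂ v) * (mLL p ends a₁ a₂ o b - mHLL p ends a₁ a₂ v o b) -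
        (mL p ends a₁ a₂ b - mHL p ends a₁ a₂ v b) * (mL p ends a₁ a₂ o - mHL p ends a₁ a₂ v o))

/-- **`g2one`** — the cleared `β`-shift-free candidate «`G2₁`»:
`P(Q,vH)·[P(Q,bL)·P(Q,oH) − P(Q)·P(Q,bL,oH)] + P(Q)·[P(Q,vH)·P(Q,bL,vH,oU) − P(Q,bL,vH)·P(Q,vH,oU)]`
(`= P(Q)²·P(Q,vH)·[N_bo + π·Cov_Q(L_b, U_o | v ∈ C₂)]`), `oU` split as `oL + oH`. -/
noncomputable def g2one (o a₁ a₂ v b : V) : R :=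
  mH p ends a₁ a₂ v * (mL p ends a₁ a₂ b * mH p ends a₁ a₂ o - mQ p ends a₁ a₂ * mHL p ends a₁ a₂ o b) +
    mQ p ends a₁ a₂ *
      (mH p ends a₁ a₂ v * (mHLL p ends a₁ a₂ v o b + mHHL p ends a₁ a₂ v o b) -
        mHL p ends a₁ a₂ v b * (mHL p ends a₁ a₂ v o + mHH p ends a₁ a₂ v o))

/-- **`y1`** — the cleared pair-avoidance cross term
`P(Q,bL,¬vH)·P(Q,oH,¬vH) − W·P(Q,bL,oH,¬vH)` (`= P(Q)·W·(1 − π)·(−Cov_Q(L_b, H_o | v ∉ C₂))`). -/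
noncomputable def y1 (o a₁ a₂ v b : V) : R :=
  (mL p ends a₁ a₂ b - mHL p ends a₁ a₂ v b) * (mH p ends a₁ a₂ o - mHH p ends a₁ a₂ v o) -
    (mQ p ends a₁ a₂ - mH p ends a₁ a₂ v) * (mHL p ends a₁ a₂ o b - mHHL p ends a₁ a₂ v o b)

/-- **`shiftB`** `= P(Q,bL)·P(Q,vH) − P(Q)·P(Q,bL,vH) = anticov(vH, bL)` (`≥ 0`, BHK 1.4). -/
noncomputable def shiftB (a₁ a₂ v b : V) : R :=
  mL p ends a₁ a₂ b * mH p ends a₁ a₂ v - mQ p ends a₁ a₂ * mHL p ends a₁ a₂ v b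

/-- **`shiftU`** `= P(Q,oU)·P(Q,vH) − P(Q)·P(Q,vH,oU) = −P(Q)²·Cov_Q(U_o, H_v)` (either sign). -/
noncomputable def shiftU (o a₁ a₂ v : V) : R :=
  (mL p ends a₁ a₂ o + mH p ends a₁ a₂ o) * mH p ends a₁ a₂ v -
    mQ p ends a₁ a₂ * (mHL p ends a₁ a₂ v o + mHH p ends a₁ a₂ v o)

end Defs

section Identities

variable (p : E → R) (ends : E → Sym2 V)

omit [Fintype V] [DecidableEq V] [LinearOrder R] [IsStrictOrderedRing R] in
/-- **The split**: `groupL = starL + g2one + P(Q)·y1`. -/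
theorem groupL_eq_split (o a₁ a₂ v b : V) :
    groupL p ends o a₁ a₂ v b =
      starL p ends o a₁ a₂ v b + g2one p ends o a₁ a₂ v b + mQ p ends a₁ a₂ * y1 p ends o a₁ a₂ v b := by
  unfold groupL anticov threeC mU starL g2one y1 mQ mL mH mHL mLL mHH mHLL mHHL
  ring

omit [Fintype V] [DecidableEq V] [LinearOrder R] [IsStrictOrderedRing R] in
/-- **The regime identity**: `groupL · W = P(Q)·starL + P(Q)²·y1 − shiftB·shiftU`, `W = P(Q) − P(Q,vH)`. -/
theorem groupL_mul_W_eq (o a₁ a₂ v b : V) :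
    groupL p ends o a₁ a₂ v b * (mQ p ends a₁ a₂ - mH p ends a₁ a₂ v) =
      mQ p ends a₁ a₂ * starL p ends o a₁ a₂ v b + mQ p ends a₁ a₂ ^ 2 * y1 p ends o a₁ a₂ v b -
        shiftB p ends a₁ a₂ v b * shiftU p ends o a₁ a₂ v := by
  unfold groupL anticov threeC mU starL y1 shiftB shiftU mQ mL mH mHL mLL mHH mHLL mHHL
  ring

end Identities

section Signs

variable (p : E → R) (ends : E → Sym2 V)

/-- **`0 ≤ y1`**: BHK06 Thm 1.4 under the pair avoidance `{a₂ ↮ a₁, a₂ ↮ v}` (`cross_pair_avoid`). -/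
theorem y1_nonneg (hp : IsProbVec p) (o a₁ a₂ v b : V) : 0 ≤ y1 p ends o a₁ a₂ v b := by
  have h := cross_pair_avoid p ends hp o a₁ a₂ v b
  unfold y1 mQ mL mH mHL mHH mHHL
  linarith

/-- **`0 ≤ shiftB`**: `anticov(vH, bL) ≥ 0` (BHK06 Thm 1.4 under `Q`). -/
theorem shiftB_nonneg (hp : IsProbVec p) (a₁ a₂ v b : V) : 0 ≤ shiftB p ends a₁ a₂ v b := by
  have h := anticov_nonneg_of_cross' p ends hp a₁ a₂ v b
  unfold anticov at h
  unfold shiftB mQ mL mH mHL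
  linarith

/-- **BHK06 Thm 1.1 for the two `C₁`-events `o ∈ C₁`, `b ∈ C₁` under `Q`**:
`P(Q, oL)·P(Q, bL) ≤ P(Q, oL, bL)·P(Q)`. -/
theorem same_cluster_bo (hp : IsProbVec p) (o a₁ a₂ b : V) :
    mL p ends a₁ a₂ o * mL p ends a₁ a₂ b ≤ mLL p ends a₁ a₂ o b * mQ p ends a₁ a₂ := by
  have h := bhk_same_cluster_events p hp ends a₁ a₂ (isUpperSet_mem_setOf o) (isUpperSet_mem_setOf b)
  rw [← connEvent_eq_clusterInEvent ends a₁ o, ← connEvent_eq_clusterInEvent ends a₁ b,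
    ← Q_eq_compl_conn ends a₂ a₁, avoidAll_root_swap ends a₁ a₂] at h
  have e1 : connEvent ends a₁ o ∩ avoidAll ends a₂ {a₁} =
      avoidAll ends a₂ {a₁} ∩ connEvent ends a₁ o := Set.inter_comm _ _
  have e2 : connEvent ends a₁ b ∩ avoidAll ends a₂ {a₁} =
      avoidAll ends a₂ {a₁} ∩ connEvent ends a₁ b := Set.inter_comm _ _
  have e3 : connEvent ends a₁ o ∩ connEvent ends a₁ b ∩ avoidAll ends a₂ {a₁} =
      avoidAll ends a₂ {a₁} ∩ (connEvent ends a₁ o ∩ connEvent ends a₁ b) := Set.inter_comm _ _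
  rw [e1, e2, e3] at h
  unfold mL mLL mQ
  exact h

omit [Fintype V] in
/-- `W = P(a₂ ↮ {a₁, v}) ≥ 0`. -/
theorem W_nonneg (hp : IsProbVec p) (a₁ a₂ v : V) : 0 ≤ mQ p ends a₁ a₂ - mH p ends a₁ a₂ v := by
  unfold mQ mH
  rw [← prob_avoidAll_pair]
  exact prob_nonneg hp _

end Signs

section Consequences

variable (p : E → R) (ends : E → Sym2 V)

/-- **`0 ≤ groupL` from the two candidates**: `0 ≤ starL → 0 ≤ g2one → 0 ≤ groupL`. -/
theorem groupL_nonneg_of_star_g2one (hp : IsProbVec p) (o a₁ a₂ v b : V)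
    (h1 : 0 ≤ starL p ends o a₁ a₂ v b) (h2 : 0 ≤ g2one p ends o a₁ a₂ v b) :
    0 ≤ groupL p ends o a₁ a₂ v b := by
  rw [groupL_eq_split]
  have hy := y1_nonneg p ends hp o a₁ a₂ v b
  have hQ : 0 ≤ mQ p ends a₁ a₂ := prob_nonneg hp _
  have := mul_nonneg hQ hy
  linarith

omit [Fintype V] [DecidableEq V] [LinearOrder R] [IsStrictOrderedRing R] in
/-- `groupH` is `groupL` with the roots swapped. -/
theorem groupH_eq_groupL_swap (o a₁ a₂ v b : V) :
    groupH p ends o a₁ a₂ v b = groupL p ends o a₂ a₁ v b := by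
  rw [groupH_eq_crossA_add_crossB, groupL_eq_crossA_add_crossB]

/-- **Row (LEAF-½) from the four candidate statements** (`starL`, `g2one` on both halves). -/
theorem LeafRow_of_star_g2one (hp : IsProbVec p) (o a₁ a₂ v b : V)
    (hL1 : 0 ≤ starL p ends o a₁ a₂ v b) (hL2 : 0 ≤ g2one p ends o a₁ a₂ v b)
    (hH1 : 0 ≤ starL p ends o a₂ a₁ v b) (hH2 : 0 ≤ g2one p ends o a₂ a₁ v b) :
    LeafRow p ends o a₁ a₂ v b := by
  apply LeafRow_of_G2 p ends hp o a₁ a₂ v b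
  · exact groupL_nonneg_of_star_g2one p ends hp o a₁ a₂ v b hL1 hL2
  · rw [groupH_eq_groupL_swap]
    exact groupL_nonneg_of_star_g2one p ends hp o a₂ a₁ v b hH1 hH2

/-- **The regime theorem**: `0 ≤ groupL` from `0 ≤ starL` alone whenever `Cov_Q(U_o, H_v) ≥ 0`
(`shiftU ≤ 0`). Proof: `groupL · W = P(Q)·starL + P(Q)²·y1 − shiftB·shiftU ≥ 0` with `W > 0`; in the
corner `W = 0` every `¬v`-mass vanishes and `groupL = P(Q)·[P(Q)·P(Q,bL,oL) − P(Q,bL)·P(Q,oL)] ≥ 0`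
by BHK06 Thm 1.1 (`same_cluster_bo`). -/
theorem groupL_nonneg_of_star_of_cov_nonneg (hp : IsProbVec p) (o a₁ a₂ v b : V)
    (h1 : 0 ≤ starL p ends o a₁ a₂ v b) (hU : shiftU p ends o a₁ a₂ v ≤ 0) :
    0 ≤ groupL p ends o a₁ a₂ v b := by
  have hid := groupL_mul_W_eq p ends o a₁ a₂ v b
  have hy := y1_nonneg p ends hp o a₁ a₂ v b
  have hB := shiftB_nonneg p ends hp a₁ a₂ v b
  have hQ : 0 ≤ mQ p ends a₁ a₂ := prob_nonneg hp _
  have hW := W_nonneg p ends hp a₁ a₂ v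
  rcases lt_or_eq_of_le hW with hWpos | hWzero
  · have hprod : 0 ≤ groupL p ends o a₁ a₂ v b * (mQ p ends a₁ a₂ - mH p ends a₁ a₂ v) := by
      rw [hid]
      have := mul_nonneg hQ h1
      have := mul_nonneg (sq_nonneg (mQ p ends a₁ a₂)) hy
      have := mul_nonneg hB (neg_nonneg.2 hU)
      nlinarith
    exact nonneg_of_mul_nonneg_left hprod hWpos
  · -- the degenerate corner `P(Q, v ∉ C₂) = 0`: every `¬v`-mass vanishes
    have hPA := same_cluster_bo p ends hp o a₁ a₂ b
    have hbound : ∀ X : Set (Config E),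
        prob p (avoidAll ends a₂ {a₁} ∩ X) - prob p (avoidAll ends a₂ {a₁} ∩ (connEvent ends a₂ v ∩ X)) = 0 := by
      intro X
      have h0 : 0 ≤ prob p (avoidAll ends a₂ {a₁} ∩ X) -
          prob p (avoidAll ends a₂ {a₁} ∩ (connEvent ends a₂ v ∩ X)) := by
        rw [← prob_inter_avoidAll_pair]; exact prob_nonneg hp _
      have h1' : prob p (avoidAll ends a₂ {a₁} ∩ X) -
          prob p (avoidAll ends a₂ {a₁} ∩ (connEvent ends a₂ v ∩ X)) ≤
          prob p (avoidAll ends a₂ {a₁}) - prob p (avoidAll ends a₂ {a₁} ∩ connEvent ends a₂ v) := by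
        rw [← prob_avoidAll_pair, ← prob_inter_avoidAll_pair]
        exact prob_mono hp Set.inter_subset_right
      unfold mQ mH at hWzero
      linarith
    have eB := hbound (connEvent ends a₁ b)
    have eL := hbound (connEvent ends a₁ o)
    have eO := hbound (connEvent ends a₂ o)
    have eBL := hbound (connEvent ends a₁ o ∩ connEvent ends a₁ b)
    have eBO := hbound (connEvent ends a₂ o ∩ connEvent ends a₁ b)
    unfold groupL anticov threeC mU
    unfold mL mLL mQ at hPA
    unfold mQ mH at hWzero
    have eV : prob p (avoidAll ends a₂ {a₁} ∩ connEvent ends a₂ v) = prob p (avoidAll ends a₂ {a₁}) := by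
      linarith
    rw [eV]
    have eB' : prob p (avoidAll ends a₂ {a₁} ∩ (connEvent ends a₂ v ∩ connEvent ends a₁ b)) =
        prob p (avoidAll ends a₂ {a₁} ∩ connEvent ends a₁ b) := by linarith
    have eL' : prob p (avoidAll ends a₂ {a₁} ∩ (connEvent ends a₂ v ∩ connEvent ends a₁ o)) =
        prob p (avoidAll ends a₂ {a₁} ∩ connEvent ends a₁ o) := by linarith
    have eO' : prob p (avoidAll ends a₂ {a₁} ∩ (connEvent ends a₂ v ∩ connEvent ends a₂ o)) =
        prob p (avoidAll ends a₂ {a₁} ∩ connEvent ends a₂ o) := by linarith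
    have eBL' : prob p (avoidAll ends a₂ {a₁} ∩
        (connEvent ends a₂ v ∩ (connEvent ends a₁ o ∩ connEvent ends a₁ b))) =
        prob p (avoidAll ends a₂ {a₁} ∩ (connEvent ends a₁ o ∩ connEvent ends a₁ b)) := by linarith
    have eBO' : prob p (avoidAll ends a₂ {a₁} ∩
        (connEvent ends a₂ v ∩ (connEvent ends a₂ o ∩ connEvent ends a₁ b))) =
        prob p (avoidAll ends a₂ {a₁} ∩ (connEvent ends a₂ o ∩ connEvent ends a₁ b)) := by linarith
    rw [eB', eL', eO', eBL', eBO']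
    have key := mul_nonneg hQ (sub_nonneg.2 hPA)
    unfold mQ at key hQ
    linarith [key]

end Consequences

end LeafHalfCross

end Summit.Ventures.PercRepro2

/-! ## ERRATUM (p5 g26, 2026-08-28T16:3xZ, STATUS 10362 / 10390) — the candidate `0 ≤ starL` is FALSE

The module docstring above calls `0 ≤ starL` «census-true, an instance of the one-cluster candidate (STAR)».
Both are withdrawn: the one-cluster statement (STAR) — `P(s↮X)·Cov(𝓕,𝓖 | s↮X) ≥ P(s↮X∪{v})·Cov(𝓕,𝓖 | s↮X∪{v})` —
fails already for the plain cluster of a vertex on five vertices (edges `03 13 14 23 24 34`, weights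
`(1/64, 1/16, 15/16, 1/2, 1/2, 63/64)`, `C = C(4)`, `v = 0`, `𝓕 = {1 ∈ C}`, `𝓖 = {2 ∈ C}`: the cleared slack is
`−276207523/5912009598042112`), and `starL < 0` on the seven-vertex instance `E = {01, 02, 05, 14, 15, 24, 26, 34, 35, 56}`,
`p = (63, 63, 1, 59, 63, 36, 63, 62, 32, 1)/64`, `(a₁, a₂, b, o, v) = (2, 1, 4, 0, 6)`
(`starL = −4557661248011976083286364266405/5708990770823839524233143877797980545530986496`), where `groupL > 0`
(the `y1` term is load-bearing). Every theorem of this file is unaffected (they are identities and implications);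
`groupL_nonneg_of_star_of_cov_nonneg` applies exactly where `0 ≤ starL` holds. The candidate of record for the row
remains `0 ≤ groupL` itself (`proofs/P5-OEDGE.md` §33 addendum 1, `proofs/subclaims/S4-HARDSTEP.md` v107). -/
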